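import Summits.AtomisticToContinuum.HydrodynamicLimit.Theses.AntiMazurCoboundaries
import Literature.MathematicalPhysics.KineticTheory.HardSphereEulerProofs
import Literature.MathematicalPhysics.KineticTheory.HardSphereUniformGas

/-!
# Exchangeability of one redrawn velocity under the homogeneous Gibbs law (sub-stub W11 of the line `cutoff-compactness-net`)

Registered sub-stub `stub_resamplingSwap` of the crux `AntiMazurCoboundaries.ShearStressHalfDrude`
(stmt-AtomisticToContinuum-14136), hypothesis 1 of the glue `stub_frozenModulation_of_loc` of the
reshaped stub S4. Write `G_N = localGibbsLaw σ a u₀ θ N Φ` (constant profiles), `M = N(u₀, θ id)`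
(`gaussMeasure u₀ θ`) and, for a configuration `z` and a velocity `v'`,
`z^{(i ← v')} := update z i (xᵢ, v')` (velocity `i` redrawn). The pair `(z, z^{(i ← v')})` is
EXCHANGEABLE under `G_N ⊗ M`:

* `stub_resamplingSwap`: `∫ G_N(dz) ∫ M(dv') H(z, z^{(i ← v')}) = ∫ G_N(dz) ∫ M(dv') H(z^{(i ← v')}, z)`
  for every measurable `H ≥ 0`;
* `measurePreserving_resampleSwap`: the redraw involution `S(z, v') := (z^{(i ← v')}, vᵢ)` of
  `Config × V3` preserves `G_N ⊗ M` (`lintegral_comp_resampleSwap`, `integral_comp_resampleSwap`: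
  the changes of variables along `S`; `resampleSwap_involutive`);
* `integral_integral_resampleSwap`: the Bochner form of the exchangeability for an `H` integrable
  against `G_N ⊗ M`.

Proof. By the rung-0 product structure `G_N = zipConfig_# (posGibbsMeasure ⊗ M^{⊗(N+1)})`
(`localGibbsMeasure_rung0_eq_map` of `Literature/…/HardSphereUniformGas`; redrawing velocity `i` of
`zipConfig (x, v)` is `zipConfig (x, update v i v')`) and Tonelli over the positions, the claim is the
exchangeability of one redrawn coordinate of the product measure `M^{⊗(N+1)}`
(`lintegral_lintegral_update_comm`): splitting off coordinate `i`
(`MeasurableEquiv.piFinSuccAbove`, `measurePreserving_piFinSuccAbove`; `lintegral_pi_eq_lintegral_insertNth`)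
both sides become `∫ M^{⊗N}(dr) ∬ K(ins_i(a, r), ins_i(b, r)) M(da) M(db)` up to the order of the two
inner integrations (`Fin.update_insertNth`, `lintegral_lintegral_swap`). Measure preservation of `S`
is the case `H(z, w) = f(w, vᵢ)` (`Measure.ext_of_lintegral`), and the Bochner forms follow by the change
of variables along the measurable involution `S` (`MeasurableEquiv.ofInvolutive`).
-/

noncomputable section

namespace Summit.AtomisticToContinuum.HydrodynamicLimit.Theorems

open MeasureTheory ProbabilityTheory Filter Set
open scoped ENNReal InnerProductSpace BigOperators
open Literature.Analysis.FluidPDE Literature.MathematicalPhysics.KineticTheory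

namespace ShearStressHalfDrudeSwap

/-! ## Product measures: one redrawn coordinate is exchangeable -/

/-- **Tonelli along one coordinate of a finite product measure**: for measurable `f ≥ 0`,
`∫ f dμ^{⊗(n+1)} = ∫ μ^{⊗n}(dr) ∫ μ(dy) f(ins_i(y, r))` (split off coordinate `i` by the measurable
equivalence `MeasurableEquiv.piFinSuccAbove`, `measurePreserving_piFinSuccAbove`, then
`lintegral_prod_symm`). [folklore] -/
theorem lintegral_pi_eq_lintegral_insertNth {Y : Type*} [MeasurableSpace Y] (μ : Measure Y)
    [SigmaFinite μ] {n : ℕ} (i : Fin (n + 1)) {f : (Fin (n + 1) → Y) → ℝ≥0∞} (hf : Measurable f) :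
    ∫⁻ v, f v ∂(Measure.pi fun _ : Fin (n + 1) => μ) =
      ∫⁻ r, ∫⁻ y, f (i.insertNth y r) ∂μ ∂(Measure.pi fun _ : Fin n => μ) := by
  have hmp : MeasurePreserving (fun p : Y × (Fin n → Y) => (i.insertNth p.1 p.2 : Fin (n + 1) → Y))
      (μ.prod (Measure.pi fun _ : Fin n => μ)) (Measure.pi fun _ : Fin (n + 1) => μ) :=
    (measurePreserving_piFinSuccAbove (fun _ : Fin (n + 1) => μ) i).symm _
  have hfm : Measurable fun p : Y × (Fin n → Y) => f (i.insertNth p.1 p.2) := hf.comp hmp.measurable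
  rw [← hmp.lintegral_comp hf, lintegral_prod_symm _ hfm.aemeasurable]

/-- **One redrawn coordinate of a product measure is exchangeable** (Tonelli form): for measurable
`K ≥ 0` on pairs,
`∫ μ^{⊗(n+1)}(dv) ∫ μ(dy) K(v, v^{(i ← y)}) = ∫ μ^{⊗(n+1)}(dv) ∫ μ(dy) K(v^{(i ← y)}, v)`,
`v^{(i ← y)} := update v i y`: after splitting off coordinate `i` both sides are
`∫ μ^{⊗n}(dr) ∬ K(ins_i(a, r), ins_i(b, r)) μ(da) μ(db)` up to the order of the two inner integrations
(`Fin.update_insertNth`, `lintegral_lintegral_swap`). [folklore] -/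
theorem lintegral_lintegral_update_comm {Y : Type*} [MeasurableSpace Y] (μ : Measure Y)
    [SigmaFinite μ] {n : ℕ} (i : Fin (n + 1)) {K : (Fin (n + 1) → Y) → (Fin (n + 1) → Y) → ℝ≥0∞}
    (hK : Measurable (Function.uncurry K)) :
    ∫⁻ v, ∫⁻ y, K v (Function.update v i y) ∂μ ∂(Measure.pi fun _ : Fin (n + 1) => μ) =
      ∫⁻ v, ∫⁻ y, K (Function.update v i y) v ∂μ ∂(Measure.pi fun _ : Fin (n + 1) => μ) := by
  have hU : Measurable fun p : (Fin (n + 1) → Y) × Y => Function.update p.1 i p.2 :=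
    measurable_update' (a := i)
  have hL : Measurable fun v : Fin (n + 1) → Y => ∫⁻ y, K v (Function.update v i y) ∂μ :=
    (hK.comp (measurable_fst.prodMk hU)).lintegral_prod_right'
  have hR : Measurable fun v : Fin (n + 1) → Y => ∫⁻ y, K (Function.update v i y) v ∂μ :=
    (hK.comp (hU.prodMk measurable_fst)).lintegral_prod_right'
  have he : Measurable fun p : Y × (Fin n → Y) => (i.insertNth p.1 p.2 : Fin (n + 1) → Y) :=
    (MeasurableEquiv.piFinSuccAbove (fun _ : Fin (n + 1) => Y) i).symm.measurable
  rw [lintegral_pi_eq_lintegral_insertNth μ i hL, lintegral_pi_eq_lintegral_insertNth μ i hR]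
  simp only [Fin.update_insertNth]
  refine lintegral_congr fun r => ?_
  have hr : Measurable fun p : Y × Y =>
      ((i.insertNth p.1 r : Fin (n + 1) → Y), (i.insertNth p.2 r : Fin (n + 1) → Y)) :=
    (he.comp (measurable_fst.prodMk measurable_const)).prodMk
      (he.comp (measurable_snd.prodMk measurable_const))
  exact lintegral_lintegral_swap
    (f := fun a b => K (i.insertNth a r) (i.insertNth b r)) (hK.comp hr).aemeasurable

/-- The same exchangeability on `P ⊗ μ^{⊗(n+1)}` with a spectator factor `P` (the positions):
`∫ (P ⊗ μ^{⊗(n+1)})(dp) ∫ μ(dy) K(p, p^{(i ← y)}) = ∫ (P ⊗ μ^{⊗(n+1)})(dp) ∫ μ(dy) K(p^{(i ← y)}, p)`,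
`p^{(i ← y)} := (p.1, update p.2 i y)` (Tonelli over `P`, then `lintegral_lintegral_update_comm`
fibrewise). [folklore] -/
theorem lintegral_lintegral_update_comm_prod {X Y : Type*} [MeasurableSpace X] [MeasurableSpace Y]
    (P : Measure X) (μ : Measure Y) [SigmaFinite μ] {n : ℕ} (i : Fin (n + 1))
    {K : X × (Fin (n + 1) → Y) → X × (Fin (n + 1) → Y) → ℝ≥0∞}
    (hK : Measurable (Function.uncurry K)) :
    ∫⁻ p, ∫⁻ y, K p (p.1, Function.update p.2 i y) ∂μ
        ∂(P.prod (Measure.pi fun _ : Fin (n + 1) => μ)) =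
      ∫⁻ p, ∫⁻ y, K (p.1, Function.update p.2 i y) p ∂μ
        ∂(P.prod (Measure.pi fun _ : Fin (n + 1) => μ)) := by
  have hU : Measurable fun q : (X × (Fin (n + 1) → Y)) × Y =>
      (q.1.1, Function.update q.1.2 i q.2) :=
    (measurable_fst.comp measurable_fst).prodMk
      ((measurable_update' (a := i)).comp
        ((measurable_snd.comp measurable_fst).prodMk measurable_snd))
  have hL : Measurable fun p : X × (Fin (n + 1) → Y) =>
      ∫⁻ y, K p (p.1, Function.update p.2 i y) ∂μ :=
    (hK.comp (measurable_fst.prodMk hU)).lintegral_prod_right'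
  have hR : Measurable fun p : X × (Fin (n + 1) → Y) =>
      ∫⁻ y, K (p.1, Function.update p.2 i y) p ∂μ :=
    (hK.comp (hU.prodMk measurable_fst)).lintegral_prod_right'
  rw [lintegral_prod _ hL.aemeasurable, lintegral_prod _ hR.aemeasurable]
  refine lintegral_congr fun x => ?_
  have hx : Measurable fun q : (Fin (n + 1) → Y) × (Fin (n + 1) → Y) => ((x, q.1), (x, q.2)) :=
    (measurable_const.prodMk measurable_fst).prodMk (measurable_const.prodMk measurable_snd)
  exact lintegral_lintegral_update_comm μ i (K := fun v w => K (x, v) (x, w)) (hK.comp hx)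

/-! ## The homogeneous hard-sphere Gibbs law -/

/-- **Exchangeability of one redrawn velocity** (sub-stub W11 of the line `cutoff-compactness-net`
of `AntiMazurCoboundaries.ShearStressHalfDrude`): under the homogeneous hard-sphere Gibbs law `G_N`
with constant profiles `(a, u₀, θ)` and an independent `v' ~ N(u₀, θ id)`, the pair
`(z, z^{(i ← v')})`, `z^{(i ← v')} := update z i (xᵢ, v')`, is exchangeable:
`∫ G_N(dz) ∫ N(u₀, θ id)(dv') H(z, z^{(i ← v')}) = ∫ G_N(dz) ∫ N(u₀, θ id)(dv') H(z^{(i ← v')}, z)` for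
every measurable `H ≥ 0` (velocity `i` is `N(u₀, θ id)` independently of the positions and of the
other velocities: `localGibbsMeasure_rung0_eq_map` and `lintegral_lintegral_update_comm_prod`; the
hypothesis `σ ≤ 1/2` is not used). [folklore] -/
theorem stub_resamplingSwap :
    ∀ (σ a θ : ℝ) (u₀ : V3), σ ≤ 1 / 2 → 0 < a → 0 < θ →
    ∀ (N : ℕ) (Φ : HardSphereFlow (Torus.geometry (Fin 3)) (hsDiameter σ N) (N + 1)) (i : Fin (N + 1))
      (H : Config (N + 1) (Fin 3) T3 → Config (N + 1) (Fin 3) T3 → ℝ≥0∞), Measurable (Function.uncurry H) →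
      ∫⁻ z, ∫⁻ v', H z (Function.update z i ((z i).1, v')) ∂(gaussMeasure u₀ θ)
          ∂(localGibbsLaw σ (fun _ => a) (fun _ => u₀) (fun _ => θ) N Φ) =
        ∫⁻ z, ∫⁻ v', H (Function.update z i ((z i).1, v')) z ∂(gaussMeasure u₀ θ)
          ∂(localGibbsLaw σ (fun _ => a) (fun _ => u₀) (fun _ => θ) N Φ) := by
  intro σ a θ u₀ _ ha hθ N Φ i H hH
  have hz : MeasurableEmbedding
      (zipConfig : (Fin (N + 1) → T3) × (Fin (N + 1) → V3) → Config (N + 1) (Fin 3) T3) :=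
    (MeasurableEquiv.arrowProdEquivProdArrow T3 V3 (Fin (N + 1))).symm.measurableEmbedding
  -- redrawing velocity `i` of a zipped configuration redraws coordinate `i` of its velocity vector
  -- (as in `ShearStressHalfDrudeResampling.stub_resamplingOrthogonality`)
  have hupd : ∀ (p : (Fin (N + 1) → T3) × (Fin (N + 1) → V3)) (v' : V3),
      Function.update (zipConfig p) i (p.1 i, v') = zipConfig (p.1, Function.update p.2 i v') := by
    intro p v'
    funext j
    by_cases hj : j = i
    · subst hj
      simp only [Function.update_self, zipConfig_apply]
    · simp only [Function.update_of_ne hj, zipConfig_apply]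
  have hK : Measurable (Function.uncurry fun p q : (Fin (N + 1) → T3) × (Fin (N + 1) → V3) =>
      H (zipConfig p) (zipConfig q)) :=
    hH.comp ((measurable_zipConfig.comp measurable_fst).prodMk
      (measurable_zipConfig.comp measurable_snd))
  rw [localGibbsLaw_eq, localGibbsMeasure_rung0_eq_map σ ha.le hθ u₀ N, hz.lintegral_map,
    hz.lintegral_map]
  simp only [zipConfig_apply, hupd]
  exact lintegral_lintegral_update_comm_prod _ _ i hK

/-! ## The redraw involution `S(z, v') = (z^{(i ← v')}, vᵢ)` -/

/-- The redraw map `S(z, v') := (update z i (xᵢ, v'), vᵢ)` of `Config × V3` is measurable. [folklore] -/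
theorem measurable_resampleSwap (N : ℕ) (i : Fin (N + 1)) :
    Measurable fun q : Config (N + 1) (Fin 3) T3 × V3 =>
      (Function.update q.1 i ((q.1 i).1, q.2), (q.1 i).2) :=
  ((measurable_update' (a := i)).comp
      (measurable_fst.prodMk
        (((measurable_pi_apply i).comp measurable_fst).fst.prodMk measurable_snd))).prodMk
    ((measurable_pi_apply i).comp measurable_fst).snd

/-- The redraw map `S(z, v') := (update z i (xᵢ, v'), vᵢ)` is an involution: redrawing velocity `i`
twice, the second time with the original value, restores the configuration. [folklore] -/
theorem resampleSwap_involutive (N : ℕ) (i : Fin (N + 1)) :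
    Function.Involutive fun q : Config (N + 1) (Fin 3) T3 × V3 =>
      (Function.update q.1 i ((q.1 i).1, q.2), (q.1 i).2) := by
  rintro ⟨z, v'⟩
  simp only [Function.update_self, Function.update_idem, Prod.mk.eta, Function.update_eq_self]

/-- **Change of variables along the redraw involution** (Lebesgue form): for measurable `f ≥ 0` on
`Config × V3`, `∫ f(S q) (G_N ⊗ N(u₀, θ id))(dq) = ∫ f d(G_N ⊗ N(u₀, θ id))`,
`S(z, v') = (z^{(i ← v')}, vᵢ)` — the case `H(z, w) = f(w, vᵢ)` of `stub_resamplingSwap`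
(`(z^{(i ← v')})ᵢ = (xᵢ, v')`). [folklore] -/
theorem lintegral_comp_resampleSwap (σ a θ : ℝ) (u₀ : V3) (hσ : σ ≤ 1 / 2) (ha : 0 < a)
    (hθ : 0 < θ) (N : ℕ) (Φ : HardSphereFlow (Torus.geometry (Fin 3)) (hsDiameter σ N) (N + 1))
    (i : Fin (N + 1)) {f : Config (N + 1) (Fin 3) T3 × V3 → ℝ≥0∞} (hf : Measurable f) :
    ∫⁻ q, f (Function.update q.1 i ((q.1 i).1, q.2), (q.1 i).2)
        ∂((localGibbsLaw σ (fun _ => a) (fun _ => u₀) (fun _ => θ) N Φ).prod (gaussMeasure u₀ θ)) =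
      ∫⁻ q, f q
        ∂((localGibbsLaw σ (fun _ => a) (fun _ => u₀) (fun _ => θ) N Φ).prod (gaussMeasure u₀ θ)) := by
  have hfS : Measurable fun q : Config (N + 1) (Fin 3) T3 × V3 =>
      f (Function.update q.1 i ((q.1 i).1, q.2), (q.1 i).2) :=
    hf.comp (measurable_resampleSwap N i)
  have hHm : Measurable (Function.uncurry fun z w : Config (N + 1) (Fin 3) T3 => f (w, (z i).2)) :=
    hf.comp (measurable_snd.prodMk ((measurable_pi_apply i).comp measurable_fst).snd)
  have key := stub_resamplingSwap σ a θ u₀ hσ ha hθ N Φ i (fun z w => f (w, (z i).2)) hHm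
  simp only [Function.update_self] at key
  rw [lintegral_prod _ hfS.aemeasurable, lintegral_prod _ hf.aemeasurable]
  exact key

/-- **The redraw involution preserves `G_N ⊗ N(u₀, θ id)`**: the law of
`(z^{(i ← v')}, vᵢ)` under `G_N ⊗ N(u₀, θ id)` is `G_N ⊗ N(u₀, θ id)` again — the measure form of the
exchangeability of `(z, z^{(i ← v')})` (`lintegral_comp_resampleSwap`, `Measure.ext_of_lintegral`).
[folklore] -/
theorem measurePreserving_resampleSwap (σ a θ : ℝ) (u₀ : V3) (hσ : σ ≤ 1 / 2) (ha : 0 < a)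
    (hθ : 0 < θ) (N : ℕ) (Φ : HardSphereFlow (Torus.geometry (Fin 3)) (hsDiameter σ N) (N + 1))
    (i : Fin (N + 1)) :
    MeasurePreserving
      (fun q : Config (N + 1) (Fin 3) T3 × V3 => (Function.update q.1 i ((q.1 i).1, q.2), (q.1 i).2))
      ((localGibbsLaw σ (fun _ => a) (fun _ => u₀) (fun _ => θ) N Φ).prod (gaussMeasure u₀ θ))
      ((localGibbsLaw σ (fun _ => a) (fun _ => u₀) (fun _ => θ) N Φ).prod (gaussMeasure u₀ θ)) := by
  refine ⟨measurable_resampleSwap N i, Measure.ext_of_lintegral _ fun f hf => ?_⟩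
  rw [lintegral_map hf (measurable_resampleSwap N i)]
  exact lintegral_comp_resampleSwap σ a θ u₀ hσ ha hθ N Φ i hf

/-- **Change of variables along the redraw involution** (Bochner form, no integrability needed):
`∫ f(S q) (G_N ⊗ N(u₀, θ id))(dq) = ∫ f d(G_N ⊗ N(u₀, θ id))` for every `f` with values in a real
normed space (`measurePreserving_resampleSwap` along the measurable involution `S`,
`MeasurableEquiv.ofInvolutive`). [folklore] -/
theorem integral_comp_resampleSwap {E : Type*} [NormedAddCommGroup E] [NormedSpace ℝ E]
    (σ a θ : ℝ) (u₀ : V3) (hσ : σ ≤ 1 / 2) (ha : 0 < a) (hθ : 0 < θ) (N : ℕ)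
    (Φ : HardSphereFlow (Torus.geometry (Fin 3)) (hsDiameter σ N) (N + 1)) (i : Fin (N + 1))
    (f : Config (N + 1) (Fin 3) T3 × V3 → E) :
    ∫ q, f (Function.update q.1 i ((q.1 i).1, q.2), (q.1 i).2)
        ∂((localGibbsLaw σ (fun _ => a) (fun _ => u₀) (fun _ => θ) N Φ).prod (gaussMeasure u₀ θ)) =
      ∫ q, f q
        ∂((localGibbsLaw σ (fun _ => a) (fun _ => u₀) (fun _ => θ) N Φ).prod (gaussMeasure u₀ θ)) :=
  (measurePreserving_resampleSwap σ a θ u₀ hσ ha hθ N Φ i).integral_comp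
    (MeasurableEquiv.ofInvolutive _ (resampleSwap_involutive N i)
      (measurable_resampleSwap N i)).measurableEmbedding f

/-- **Exchangeability of one redrawn velocity** (Bochner form): for `H` with
`(z, v') ↦ H(z, z^{(i ← v')})` integrable against `G_N ⊗ N(u₀, θ id)`,
`∫ G_N(dz) ∫ N(u₀, θ id)(dv') H(z, z^{(i ← v')}) = ∫ G_N(dz) ∫ N(u₀, θ id)(dv') H(z^{(i ← v')}, z)`
(Fubini on both sides and the change of variables along the redraw involution, under which the
second integrand is the first: `(z^{(i ← v')})^{(i ← vᵢ)} = z`). [folklore] -/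
theorem integral_integral_resampleSwap {E : Type*} [NormedAddCommGroup E] [NormedSpace ℝ E]
    (σ a θ : ℝ) (u₀ : V3) (hσ : σ ≤ 1 / 2) (ha : 0 < a) (hθ : 0 < θ) (N : ℕ)
    (Φ : HardSphereFlow (Torus.geometry (Fin 3)) (hsDiameter σ N) (N + 1)) (i : Fin (N + 1))
    (H : Config (N + 1) (Fin 3) T3 → Config (N + 1) (Fin 3) T3 → E)
    (hH : Integrable (fun q : Config (N + 1) (Fin 3) T3 × V3 =>
        H q.1 (Function.update q.1 i ((q.1 i).1, q.2)))
      ((localGibbsLaw σ (fun _ => a) (fun _ => u₀) (fun _ => θ) N Φ).prod (gaussMeasure u₀ θ))) :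
    ∫ z, ∫ v', H z (Function.update z i ((z i).1, v')) ∂(gaussMeasure u₀ θ)
        ∂(localGibbsLaw σ (fun _ => a) (fun _ => u₀) (fun _ => θ) N Φ) =
      ∫ z, ∫ v', H (Function.update z i ((z i).1, v')) z ∂(gaussMeasure u₀ θ)
        ∂(localGibbsLaw σ (fun _ => a) (fun _ => u₀) (fun _ => θ) N Φ) := by
  haveI : IsProbabilityMeasure (localGibbsLaw σ (fun _ => a) (fun _ => u₀) (fun _ => θ) N Φ) :=
    isProbabilityMeasure_localGibbsLaw continuous_const continuous_const continuous_const
      (fun _ => ha) (fun _ => hθ) hσ N Φ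
  have hmp := measurePreserving_resampleSwap σ a θ u₀ hσ ha hθ N Φ i
  have hemb : MeasurableEmbedding fun q : Config (N + 1) (Fin 3) T3 × V3 =>
      (Function.update q.1 i ((q.1 i).1, q.2), (q.1 i).2) :=
    (MeasurableEquiv.ofInvolutive _ (resampleSwap_involutive N i)
      (measurable_resampleSwap N i)).measurableEmbedding
  -- under `S` the second integrand is the first
  have hswap : ∀ q : Config (N + 1) (Fin 3) T3 × V3,
      (fun q' : Config (N + 1) (Fin 3) T3 × V3 => H q'.1 (Function.update q'.1 i ((q'.1 i).1, q'.2)))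
          (Function.update q.1 i ((q.1 i).1, q.2), (q.1 i).2) =
        H (Function.update q.1 i ((q.1 i).1, q.2)) q.1 := by
    rintro ⟨z, v'⟩
    simp only [Function.update_self, Function.update_idem, Prod.mk.eta, Function.update_eq_self]
  have hH' : Integrable (fun q : Config (N + 1) (Fin 3) T3 × V3 =>
      H (Function.update q.1 i ((q.1 i).1, q.2)) q.1)
      ((localGibbsLaw σ (fun _ => a) (fun _ => u₀) (fun _ => θ) N Φ).prod (gaussMeasure u₀ θ)) :=
    ((hmp.integrable_comp_emb hemb).2 hH).congr (ae_of_all _ hswap)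
  rw [← integral_prod _ hH, ← integral_prod _ hH', ← hmp.integral_comp hemb]
  exact integral_congr_ae (ae_of_all _ hswap)

end ShearStressHalfDrudeSwap

end Summit.AtomisticToContinuum.HydrodynamicLimit.Theorems

end
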